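import Summits.QuantumAdvantage.AdviceFreeQNC0.CleanGapStrategies
import HarnessLib

/-!
# Cell qa-qnc0 (rung F-Q1, route RingFrame, crux α `RingToElim`): WINDOW LOCALIZATION — the
# walk game restricted to one window is the walk game on the window plus an eliminator, so
# hardness at fixed degree never fades as `n` grows

Crux α (`RingHardU`, tree `ringWinU`) asks that every polylog-degree walk strategy wins the ring
game in walk coordinates on at most `θ·2ⁿ` inputs.  Fix a window of `ℓ` input bits,
`u = a ++ w ++ b` (`glue3`), and condition on the outside blocks `(a, b)`.  Then
(`mixedWinU_glue3`):

* the window positions `p ≤ g ≤ p + ℓ` of the big strategy form a walk strategy on the `ℓ`-cube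
  (`inStrategy`: position `g' = g − p`, selector `w ↦ y_g(a ++ w ++ b)`, charge
  `c' = c + p + 2|a| + |b|`, `inCharge`) — the characters agree EXACTLY;
* an outside position `g < p` has character `A_g + |w|`, an outside position `g > p + ℓ` has
  character `C_g + 2|w|` (`gapChar` of `CleanGapStrategies`), so the outside positions
  contribute the bit `P_{|w| mod 3}(w)` of an ELIMINATOR TRIPLE `(P_0, P_1, P_2)` — `P_r(w)` is
  the parity of the restricted outside selectors over the fixed set `{g : gapChar(g, r) ≢ 0}`
  (`outParity`), of the same degree (`hasDeg_outParity`), and `P_0 ⊕ P_1 ⊕ P_2 ≡ 0`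
  (`outParity_even`: each selected position is live for exactly two residues).

This motivates the MIXED GAME on `ℓ` bits (`mixedWinU c P y w = P_{|w| mod 3}(w) ⊕ WIN_y(w)`:
a walk strategy `y` assisted by an even eliminator triple `P`) and its hardness predicate
`MixedHardAt ℓ D θ` (every mixed strategy with all selectors of degree `≤ D` wins on
`≤ θ·2^ℓ` window contents, every charge).  The fibre identity is stable under gluing
(an even triple on `u` restricts to an even triple on `w`), whence by Fubini:

* `card_mixedWinU_le_of_mixedHardAt` — **localization**: `MixedHardAt ℓ D θ` bounds every
  degree-`≤ D` mixed strategy on `p + ℓ + q` bits by `θ·2^{p+ℓ+q}`;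
* `mixedHardAt_mono` — **monotonicity**: `MixedHardAt ℓ D θ → MixedHardAt (p + ℓ + q) D θ`;
* `card_ringWinU_le_of_mixedHardAt`, `ringWinU_le_of_mixedHardAt` — **hardness at fixed degree
  never fades**: `MixedHardAt ℓ D θ` bounds every degree-`≤ D` walk strategy on every `n ≥ ℓ`
  by `θ·2ⁿ` (the walk game is the mixed game with `P ≡ 0`).

So crux α at degree `D` is a statement about ONE window length `ℓ(D)`; an exact optimum of the
mixed game at a small `(ℓ, D)` (a finite linear-code computation, as in the cell's
`walkcode_opt.py`) is a rigorous bound for ALL `n ≥ ℓ` at that degree; and the special case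
`y ≡ 0` of the mixed game is two-bit elimination (the low-degree gap theorem,
`LowDegreeGapStrategies.lean`).

The cell's statement (prover qn-prover-3, 2026-08-26); not in print.
WHAT THIS IS NOT: no hardness is proved here — `MixedHardAt ℓ D θ` with `θ < 1` at
`D ≍ √ℓ` (or polylog) is crux α itself in single-scale form; nothing on `LDMAPolylog`,
`TRPlus`; no separation.
-/

noncomputable section

namespace Summit.QuantumAdvantage.AdviceFreeQNC0

open Finset
open Literature.Computability.MetaComplexity Literature.Computability.MetaComplexity.Smolensky

/-! ### The mixed game: a walk strategy assisted by an eliminator triple -/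

/-- **The mixed game on `ℓ` bits.**  A walk strategy `y` (charge `c`) together with an
eliminator triple `P` (`P r` is consulted when `|w| ≡ r (mod 3)`): the mixed strategy WINS at
`w` iff `P_{|w| mod 3}(w) ⊕ WIN_y(w) = 1`. -/
def mixedWinU {ℓ : ℕ} (c : ℕ) (P : ℕ → (Fin ℓ → Bool) → Bool)
    (y : Fin (ℓ + 1) → (Fin ℓ → Bool) → Bool) (w : Fin ℓ → Bool) : Bool :=
  xor (P (wt w % 3) w) (ringWinU c y w)

/-- **Hardness of the mixed game at `(ℓ, D)` with constant `θ`**: every mixed strategy whose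
triple is EVEN (`P_0 ⊕ P_1 ⊕ P_2 ≡ 0`, as every triple arising from walk positions is) and whose
selectors all have degree `≤ D` wins on at most `θ·2^ℓ` window contents, for every charge. -/
def MixedHardAt (ℓ D : ℕ) (θ : ℝ) : Prop :=
  ∀ (c : ℕ) (P : ℕ → (Fin ℓ → Bool) → Bool) (y : Fin (ℓ + 1) → (Fin ℓ → Bool) → Bool),
    (∀ r, HasDeg (P r) D) → (∀ w, xor (P 0 w) (xor (P 1 w) (P 2 w)) = false) →
    (∀ g, HasDeg (y g) D) →
      ((univ.filter fun w : Fin ℓ → Bool => mixedWinU c P y w = true).card : ℝ) ≤ θ * (2 : ℝ) ^ ℓ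

/-- The walk game is the mixed game with the zero triple. -/
theorem mixedWinU_zero {ℓ : ℕ} (c : ℕ) (y : Fin (ℓ + 1) → (Fin ℓ → Bool) → Bool)
    (w : Fin ℓ → Bool) : mixedWinU c (fun _ _ => false) y w = ringWinU c y w := by
  unfold mixedWinU
  rw [Bool.false_xor]

variable {p ℓ q : ℕ}

/-! ### The window strategy and the outside triple of a glued strategy -/

/-- The charge of the window game: `c' = c + p + 2|a| + |b|`. -/
def inCharge (c : ℕ) (a : Fin p → Bool) (b : Fin q → Bool) : ℕ := c + p + 2 * wt a + wt b

/-- The window strategy: position `g' ≤ ℓ` of the window is position `p + g'` of the big game,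
its selector the restriction `w ↦ y_{p+g'}(a ++ w ++ b)`. -/
def inStrategy (y : Fin (p + ℓ + q + 1) → (Fin (p + ℓ + q) → Bool) → Bool)
    (a : Fin p → Bool) (b : Fin q → Bool) : Fin (ℓ + 1) → (Fin ℓ → Bool) → Bool :=
  fun g' w => y ⟨p + g'.val, by omega⟩ (glue3 a w b)

/-- `N_out(w; r)`: outside positions (`g < p` or `g > p + ℓ`) selected at `a ++ w ++ b` whose
character with window-weight parameter `r` is non-zero. -/
def outCount (y : Fin (p + ℓ + q + 1) → (Fin (p + ℓ + q) → Bool) → Bool) (c : ℕ)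
    (a : Fin p → Bool) (w : Fin ℓ → Bool) (b : Fin q → Bool) (r : ℕ) : ℕ :=
  (univ.filter fun g : Fin (p + ℓ + q + 1) => (g.val < p ∨ p + ℓ < g.val) ∧
    y g (glue3 a w b) = true ∧ gapChar ℓ c a b g.val r % 3 ≠ 0).card

/-- The outside triple: `P_r(w) = [N_out(w; r) odd]`. -/
def outParity (y : Fin (p + ℓ + q + 1) → (Fin (p + ℓ + q) → Bool) → Bool) (c : ℕ)
    (a : Fin p → Bool) (b : Fin q → Bool) (r : ℕ) (w : Fin ℓ → Bool) : Bool :=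
  decide (outCount y c a w b r % 2 = 1)

/-- `N_out(w; r)` depends on `r` only mod `3`. -/
theorem outCount_mod (y : Fin (p + ℓ + q + 1) → (Fin (p + ℓ + q) → Bool) → Bool) (c : ℕ)
    (a : Fin p → Bool) (w : Fin ℓ → Bool) (b : Fin q → Bool) (r : ℕ) :
    outCount y c a w b r = outCount y c a w b (r % 3) :=
  congrArg Finset.card (Finset.filter_congr fun g _ => by rw [gapChar_mod ℓ c a b g.val r])

variable (c : ℕ) (y : Fin (p + ℓ + q + 1) → (Fin (p + ℓ + q) → Bool) → Bool)

/-- Prefix weights inside the window: `W_{p+g'}(a ++ w ++ b) = |a| + W_{g'}(w)` for `g' ≤ ℓ`. -/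
theorem wtPrefix_glue3_window (a : Fin p → Bool) (w : Fin ℓ → Bool) (b : Fin q → Bool) {g' : ℕ}
    (hg : g' ≤ ℓ) : wtPrefix (glue3 a w b) (p + g') = wt a + wtPrefix w g' := by
  unfold glue3
  rw [wtPrefix_append_of_le _ _ (by omega : p + g' ≤ p + ℓ), wtPrefix_append_of_ge _ _ (by omega),
    Nat.add_sub_cancel_left]

/-- Parities add: `[(A + B) odd] = [A odd] ⊕ [B odd]`. [folklore] -/
private theorem decide_add_odd (A B : ℕ) :
    decide ((A + B) % 2 = 1) = xor (decide (A % 2 = 1)) (decide (B % 2 = 1)) := by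
  rcases Nat.mod_two_eq_zero_or_one A with hA | hA <;>
    rcases Nat.mod_two_eq_zero_or_one B with hB | hB <;>
      simp [Nat.add_mod, hA, hB]

/-- **The fibre identity for the walk game.**  On `a ++ w ++ b` the big strategy wins iff
`P_{|w| mod 3}(w) ⊕ WIN'(w) = 1`, with `P` the outside triple and `WIN'` the win bit of the
window strategy at charge `c'`: the walk game restricted to a window fibre IS a mixed game. -/
theorem ringWinU_glue3_eq_mixedWinU (a : Fin p → Bool) (w : Fin ℓ → Bool) (b : Fin q → Bool) :
    ringWinU c y (glue3 a w b) =
      mixedWinU (inCharge c a b) (outParity y c a b) (inStrategy y a b) w := by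
  classical
  unfold mixedWinU outParity
  rw [← outCount_mod]
  unfold ringWinU outCount inStrategy
  -- split the selected live positions of the big game into outside and window positions
  set S := univ.filter fun g : Fin (p + ℓ + q + 1) =>
    y g (glue3 a w b) = true ∧ (c + g.val + walkExp (glue3 a w b) g.val) % 3 ≠ 0 with hS
  set Sout := univ.filter fun g : Fin (p + ℓ + q + 1) => (g.val < p ∨ p + ℓ < g.val) ∧
    y g (glue3 a w b) = true ∧ gapChar ℓ c a b g.val (wt w) % 3 ≠ 0 with hSout
  set Sin := univ.filter fun g' : Fin (ℓ + 1) =>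
    y ⟨p + g'.val, by omega⟩ (glue3 a w b) = true ∧
      (inCharge c a b + g'.val + walkExp w g'.val) % 3 ≠ 0 with hSin
  -- outside part of `S`
  have hout : S.filter (fun g => g.val < p ∨ p + ℓ < g.val) = Sout := by
    rw [hS, hSout, Finset.filter_filter]
    refine Finset.filter_congr fun g _ => ?_
    constructor
    · rintro ⟨⟨h1, h2⟩, hg⟩
      refine ⟨hg, h1, ?_⟩
      unfold walkExp at h2; unfold gapChar
      rcases hg with hg | hg
      · rwa [if_pos (by omega : g.val ≤ p), ← wtPrefix_glue3_of_le a w b (by omega : g.val ≤ p),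
          ← wt_glue3]
      · rwa [if_neg (by omega : ¬ g.val ≤ p), ← wtPrefix_glue3_of_ge a w b (by omega : p + ℓ ≤ g.val),
          ← wt_glue3]
    · rintro ⟨hg, h1, h2⟩
      refine ⟨⟨h1, ?_⟩, hg⟩
      unfold walkExp; unfold gapChar at h2
      rcases hg with hg | hg
      · rwa [if_pos (by omega : g.val ≤ p), ← wtPrefix_glue3_of_le a w b (by omega : g.val ≤ p),
          ← wt_glue3] at h2
      · rwa [if_neg (by omega : ¬ g.val ≤ p), ← wtPrefix_glue3_of_ge a w b (by omega : p + ℓ ≤ g.val),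
          ← wt_glue3] at h2
  -- window part of `S`: the image of `Sin` under `g' ↦ p + g'`
  let emb : Fin (ℓ + 1) ↪ Fin (p + ℓ + q + 1) :=
    ⟨fun g' => ⟨p + g'.val, by omega⟩, fun g₁ g₂ h => Fin.ext (by
      have := congrArg Fin.val h; simp only at this; omega)⟩
  have hin : S.filter (fun g => ¬ (g.val < p ∨ p + ℓ < g.val)) = Sin.map emb := by
    ext g
    rw [Finset.mem_filter, hS, Finset.mem_filter, Finset.mem_map]
    constructor
    · rintro ⟨⟨_, h1, h2⟩, hg⟩
      have hgp : p ≤ g.val ∧ g.val ≤ p + ℓ := by omega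
      refine ⟨⟨g.val - p, by omega⟩, ?_, Fin.ext (by simp [emb]; omega)⟩
      rw [hSin, Finset.mem_filter]
      have hcast : (⟨p + (g.val - p), by omega⟩ : Fin (p + ℓ + q + 1)) = g := Fin.ext (by simp; omega)
      refine ⟨mem_univ _, by rw [hcast]; exact h1, ?_⟩
      unfold walkExp at h2 ⊢
      rw [show g.val = p + (g.val - p) by omega, wtPrefix_glue3_window a w b (by omega : g.val - p ≤ ℓ),
        wt_glue3] at h2
      unfold inCharge
      dsimp only
      intro h3; apply h2; omega
    · rintro ⟨g', hg', rfl⟩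
      rw [hSin, Finset.mem_filter] at hg'
      obtain ⟨_, h1, h2⟩ := hg'
      refine ⟨⟨mem_univ _, h1, ?_⟩, by simp [emb]; omega⟩
      unfold walkExp at h2 ⊢
      simp only [emb, Function.Embedding.coeFn_mk]
      rw [wtPrefix_glue3_window a w b (by omega : g'.val ≤ ℓ), wt_glue3]
      unfold inCharge at h2
      intro h3; apply h2; omega
  have hcard : S.card = Sout.card + Sin.card := by
    rw [← Finset.card_filter_add_card_filter_not (s := S) (fun g : Fin (p + ℓ + q + 1) =>
      g.val < p ∨ p + ℓ < g.val), hout, hin, Finset.card_map]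
  rw [hcard, decide_add_odd]

/-! ### The outside triple is even and of the same degree -/

/-- `N_out(w;0) + N_out(w;1) + N_out(w;2)` is even: every selected outside position is live for
exactly two residues. -/
theorem outCount_sum_even (a : Fin p → Bool) (w : Fin ℓ → Bool) (b : Fin q → Bool) :
    (outCount y c a w b 0 + outCount y c a w b 1 + outCount y c a w b 2) % 2 = 0 := by
  set S := univ.filter fun g : Fin (p + ℓ + q + 1) => (g.val < p ∨ p + ℓ < g.val) ∧
    y g (glue3 a w b) = true with hS
  have hcount : ∀ r, outCount y c a w b r =
      ∑ g ∈ S, (if gapChar ℓ c a b g.val r % 3 ≠ 0 then 1 else 0) := by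
    intro r
    unfold outCount
    rw [hS, Finset.sum_filter, Finset.card_filter]
    refine Finset.sum_congr rfl fun g _ => ?_
    by_cases h1 : (g.val < p ∨ p + ℓ < g.val) ∧ y g (glue3 a w b) = true <;>
      by_cases h2 : gapChar ℓ c a b g.val r % 3 ≠ 0 <;> simp_all
  have h : ∑ r ∈ range 3, outCount y c a w b r = S.card * 2 := by
    simp_rw [hcount]
    rw [Finset.sum_comm, Finset.sum_congr rfl fun g _ => sum_range_three_gapChar_ne ℓ c a b g.val,
      Finset.sum_const, smul_eq_mul]
  rw [Finset.sum_range_succ, Finset.sum_range_succ, Finset.sum_range_succ, Finset.sum_range_zero,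
    zero_add] at h
  omega

/-- The outside triple is even: `P_0 ⊕ P_1 ⊕ P_2 ≡ 0`. -/
theorem outParity_even (a : Fin p → Bool) (b : Fin q → Bool) (w : Fin ℓ → Bool) :
    xor (outParity y c a b 0 w) (xor (outParity y c a b 1 w) (outParity y c a b 2 w)) = false := by
  have h := outCount_sum_even c y a w b
  unfold outParity
  rcases Nat.mod_two_eq_zero_or_one (outCount y c a w b 0) with h0 | h0 <;>
    rcases Nat.mod_two_eq_zero_or_one (outCount y c a w b 1) with h1 | h1 <;>
      rcases Nat.mod_two_eq_zero_or_one (outCount y c a w b 2) with h2 | h2 <;>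
        simp [h0, h1, h2] <;> omega

/-- Restriction of a selector to a window fibre keeps the degree. -/
theorem hasDeg_glue3_window {D : ℕ} (a : Fin p → Bool) (b : Fin q → Bool)
    {f : (Fin (p + ℓ + q) → Bool) → Bool} (hf : HasDeg f D) :
    HasDeg (fun w : Fin ℓ → Bool => f (glue3 a w b)) D :=
  hasDeg_append_right a (hasDeg_append_left b hf)

/-- The window strategy has the degree of the big strategy. -/
theorem hasDeg_inStrategy {D : ℕ} (hdeg : ∀ g, HasDeg (y g) D) (a : Fin p → Bool) (b : Fin q → Bool)
    (g' : Fin (ℓ + 1)) : HasDeg (inStrategy y a b g') D :=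
  hasDeg_glue3_window a b (hdeg _)

/-- The outside triple has the degree of the big strategy: `P_r` is the parity of the restricted
outside selectors over the fixed set of positions live for `r`. -/
theorem hasDeg_outParity {D : ℕ} (hdeg : ∀ g, HasDeg (y g) D) (a : Fin p → Bool) (b : Fin q → Bool)
    (r : ℕ) : HasDeg (outParity y c a b r) D := by
  have hN : ∀ w, outCount y c a w b r =
      ((((univ : Finset (Fin (p + ℓ + q + 1))).filter fun g =>
        (g.val < p ∨ p + ℓ < g.val) ∧ gapChar ℓ c a b g.val r % 3 ≠ 0).filter
          fun g => y g (glue3 a w b) = true).card) := by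
    intro w
    unfold outCount
    rw [Finset.filter_filter]
    exact congrArg Finset.card (Finset.filter_congr fun g _ => by tauto)
  have heq : outParity y c a b r = fun w => decide
      (((((univ : Finset (Fin (p + ℓ + q + 1))).filter fun g =>
        (g.val < p ∨ p + ℓ < g.val) ∧ gapChar ℓ c a b g.val r % 3 ≠ 0).filter
          fun g => y g (glue3 a w b) = true).card) % 2 = 1) := by
    funext w
    simp only [outParity, hN w]
  rw [heq]
  exact hasDeg_parity _ (fun g (w : Fin ℓ → Bool) => y g (glue3 a w b))
    fun g _ => hasDeg_glue3_window a b (hdeg g)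

/-! ### Gluing a mixed strategy: the fibre is again a mixed strategy -/

/-- The triple of the fibre: the big triple read at the shifted residue, plus the outside
triple of the big walk strategy. -/
def fibreTriple (P : ℕ → (Fin (p + ℓ + q) → Bool) → Bool) (a : Fin p → Bool) (b : Fin q → Bool)
    (r : ℕ) (w : Fin ℓ → Bool) : Bool :=
  xor (P ((r + wt a + wt b) % 3) (glue3 a w b)) (outParity y c a b r w)

/-- **The fibre identity for the mixed game.**  A mixed strategy on `a ++ w ++ b`, read on the
fibre `{a ++ w ++ b : w}`, is the mixed strategy `(fibreTriple, inStrategy)` at charge `c'`. -/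
theorem mixedWinU_glue3 (P : ℕ → (Fin (p + ℓ + q) → Bool) → Bool) (a : Fin p → Bool)
    (w : Fin ℓ → Bool) (b : Fin q → Bool) :
    mixedWinU c P y (glue3 a w b) =
      mixedWinU (inCharge c a b) (fibreTriple c y P a b) (inStrategy y a b) w := by
  unfold mixedWinU fibreTriple
  rw [ringWinU_glue3_eq_mixedWinU c y a w b]
  unfold mixedWinU
  rw [wt_glue3, show (wt w % 3 + wt a + wt b) % 3 = (wt a + wt w + wt b) % 3 by omega,
    Bool.xor_assoc]

/-- The fibre triple is even if the big triple is. -/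
theorem fibreTriple_even (P : ℕ → (Fin (p + ℓ + q) → Bool) → Bool)
    (hP : ∀ u, xor (P 0 u) (xor (P 1 u) (P 2 u)) = false) (a : Fin p → Bool) (b : Fin q → Bool)
    (w : Fin ℓ → Bool) :
    xor (fibreTriple c y P a b 0 w) (xor (fibreTriple c y P a b 1 w) (fibreTriple c y P a b 2 w)) =
      false := by
  have hout := outParity_even c y a b w
  have hPu := hP (glue3 a w b)
  unfold fibreTriple
  -- the three shifted residues are a permutation of `0, 1, 2`
  have hs : (wt a + wt b) % 3 = 0 ∨ (wt a + wt b) % 3 = 1 ∨ (wt a + wt b) % 3 = 2 := by omega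
  rcases hs with hs | hs | hs
  · rw [show (0 + wt a + wt b) % 3 = 0 by omega, show (1 + wt a + wt b) % 3 = 1 by omega,
      show (2 + wt a + wt b) % 3 = 2 by omega]
    revert hout hPu
    cases P 0 (glue3 a w b) <;> cases P 1 (glue3 a w b) <;> cases P 2 (glue3 a w b) <;>
      cases outParity y c a b 0 w <;> cases outParity y c a b 1 w <;>
        cases outParity y c a b 2 w <;> decide
  · rw [show (0 + wt a + wt b) % 3 = 1 by omega, show (1 + wt a + wt b) % 3 = 2 by omega,
      show (2 + wt a + wt b) % 3 = 0 by omega]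
    revert hout hPu
    cases P 0 (glue3 a w b) <;> cases P 1 (glue3 a w b) <;> cases P 2 (glue3 a w b) <;>
      cases outParity y c a b 0 w <;> cases outParity y c a b 1 w <;>
        cases outParity y c a b 2 w <;> decide
  · rw [show (0 + wt a + wt b) % 3 = 2 by omega, show (1 + wt a + wt b) % 3 = 0 by omega,
      show (2 + wt a + wt b) % 3 = 1 by omega]
    revert hout hPu
    cases P 0 (glue3 a w b) <;> cases P 1 (glue3 a w b) <;> cases P 2 (glue3 a w b) <;>
      cases outParity y c a b 0 w <;> cases outParity y c a b 1 w <;>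
        cases outParity y c a b 2 w <;> decide

/-- The fibre triple has the degree of the big strategy. -/
theorem hasDeg_fibreTriple {D : ℕ} (P : ℕ → (Fin (p + ℓ + q) → Bool) → Bool)
    (hP : ∀ r, HasDeg (P r) D) (hdeg : ∀ g, HasDeg (y g) D) (a : Fin p → Bool) (b : Fin q → Bool)
    (r : ℕ) : HasDeg (fibreTriple c y P a b r) D :=
  hasDeg_xor (hasDeg_glue3_window a b (hP _)) (hasDeg_outParity c y hdeg a b r)

/-! ### Localization and monotonicity -/

/-- **Localization.**  Hardness of the mixed game on `ℓ` bits at degree `D` bounds every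
degree-`≤ D` mixed strategy (even triple) on `p + ℓ + q` bits: fibre by fibre it is a mixed
strategy on the window (`mixedWinU_glue3`), then Fubini over the outside blocks. -/
theorem card_mixedWinU_le_of_mixedHardAt {D : ℕ} {θ : ℝ} (h : MixedHardAt ℓ D θ)
    (P : ℕ → (Fin (p + ℓ + q) → Bool) → Bool) (hP : ∀ r, HasDeg (P r) D)
    (hPeven : ∀ u, xor (P 0 u) (xor (P 1 u) (P 2 u)) = false) (hdeg : ∀ g, HasDeg (y g) D) :
    ((univ.filter fun u : Fin (p + ℓ + q) → Bool => mixedWinU c P y u = true).card : ℝ) ≤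
      θ * (2 : ℝ) ^ (p + ℓ + q) := by
  rw [card_filter_eq_sum_glue3]
  push_cast
  have hfib : ∀ (a : Fin p → Bool) (b : Fin q → Bool),
      ((univ.filter fun w : Fin ℓ → Bool => mixedWinU c P y (glue3 a w b) = true).card : ℝ) ≤
        θ * (2 : ℝ) ^ ℓ := by
    intro a b
    have heq : (univ.filter fun w : Fin ℓ → Bool => mixedWinU c P y (glue3 a w b) = true) =
        univ.filter fun w : Fin ℓ → Bool =>
          mixedWinU (inCharge c a b) (fibreTriple c y P a b) (inStrategy y a b) w = true :=
      Finset.filter_congr fun w _ => by rw [mixedWinU_glue3]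
    rw [heq]
    exact h _ _ _ (hasDeg_fibreTriple c y P hP hdeg a b) (fibreTriple_even c y P hPeven a b)
      (hasDeg_inStrategy y hdeg a b)
  calc ∑ a : Fin p → Bool, ∑ b : Fin q → Bool,
        ((univ.filter fun w : Fin ℓ → Bool => mixedWinU c P y (glue3 a w b) = true).card : ℝ)
      ≤ ∑ _a : Fin p → Bool, ∑ _b : Fin q → Bool, θ * (2 : ℝ) ^ ℓ :=
        Finset.sum_le_sum fun a _ => Finset.sum_le_sum fun b _ => hfib a b
    _ = θ * (2 : ℝ) ^ (p + ℓ + q) := by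
        simp only [Finset.sum_const, Finset.card_univ, Fintype.card_fun, Fintype.card_bool,
          Fintype.card_fin, nsmul_eq_mul]
        push_cast
        ring

omit c y in
/-- **Monotonicity of mixed hardness in the window length**: `MixedHardAt ℓ D θ` implies
`MixedHardAt (p + ℓ + q) D θ` for all `p, q`. -/
theorem mixedHardAt_mono {D : ℕ} {θ : ℝ} (h : MixedHardAt ℓ D θ) (p q : ℕ) :
    MixedHardAt (p + ℓ + q) D θ :=
  fun c P y hP hPeven hdeg => card_mixedWinU_le_of_mixedHardAt c y h P hP hPeven hdeg

/-- **Hardness at fixed degree never fades (glued form).**  `MixedHardAt ℓ D θ` bounds every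
degree-`≤ D` WALK strategy on `p + ℓ + q` bits by `θ·2^{p+ℓ+q}` (the walk game is the mixed game
with the zero triple). -/
theorem card_ringWinU_le_of_mixedHardAt {D : ℕ} {θ : ℝ} (h : MixedHardAt ℓ D θ)
    (hdeg : ∀ g, HasDeg (y g) D) :
    ((univ.filter fun u : Fin (p + ℓ + q) → Bool => ringWinU c y u = true).card : ℝ) ≤
      θ * (2 : ℝ) ^ (p + ℓ + q) := by
  have heq : (univ.filter fun u : Fin (p + ℓ + q) → Bool => ringWinU c y u = true) =
      univ.filter fun u : Fin (p + ℓ + q) → Bool => mixedWinU c (fun _ _ => false) y u = true :=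
    Finset.filter_congr fun u _ => by rw [mixedWinU_zero]
  rw [heq]
  exact card_mixedWinU_le_of_mixedHardAt c y h (fun _ _ => false) (fun _ => hasDeg_false D)
    (fun _ => by simp) hdeg

omit c y in
/-- **Hardness at fixed degree never fades.**  If the mixed game on `ℓ` bits is `θ`-hard at
degree `D`, then for EVERY `n ≥ ℓ`, every charge and every walk strategy on `n` bits with
selectors of degree `≤ D`, the ring game in walk coordinates is won on at most `θ·2ⁿ` inputs.
So crux α at a given degree is decided at one window length, and an exact optimum of the mixed
game at a small `(ℓ, D)` bounds all `n ≥ ℓ`. -/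
theorem ringWinU_le_of_mixedHardAt {ℓ D : ℕ} {θ : ℝ} (h : MixedHardAt ℓ D θ) :
    ∀ n : ℕ, ℓ ≤ n → ∀ c : ℕ, ∀ y : Fin (n + 1) → (Fin n → Bool) → Bool,
      (∀ g, HasDeg (y g) D) →
        ((univ.filter fun u : Fin n → Bool => ringWinU c y u = true).card : ℝ) ≤ θ * (2 : ℝ) ^ n := by
  intro n hn c y hdeg
  obtain ⟨q, rfl⟩ : ∃ q, n = 0 + ℓ + q := ⟨n - ℓ, by omega⟩
  exact card_ringWinU_le_of_mixedHardAt c y h hdeg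

end Summit.QuantumAdvantage.AdviceFreeQNC0
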